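import Summits.CriticalPhenomena.PercolationContinuityZ3.Theorems.PercNearOneGluingNoHeavyLowerTailKnQuestion8CoefficientwiseCoreClassKernelMixIETLayerCake
import HarnessLib

/-!
# Layer-cake reduction for the increasing-event transfer within a level class

Support file (`--supports stmt-CriticalPhenomena-4575`, closed), prover `prim-cplus-coupling` (gen 43).  No definitions, no notations,
no named facts, no sorries; standard axioms.  Memo `prim-cplus-coupling/A5-COUPLING-gen42.md` §5, §7 (iii); `A5-COUPLING-gen43.md`.

`…KernelMixIETLayerCake` reduces the real-level IET to its 0/1 counting form when the 0/1 form is known for ALL admissible 0/1 level systems.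
THEOREM LP1(Θ) (memo gen 42 §7; kernel: `…KernelMixBundleLP1`) gives the 0/1 form only for THREAD-SUPPORTED a/b-levels.  Since the layer-cake
thresholds `1[s ≤ f]` of a thread-supported `f` are thread-supported, the same reduction works inside any class of level functions closed under
thresholding; this file records that version:
* `Coefficientwise.iet_of_indicator_levels_class` (abstract form), `Coefficientwise.iet_graph_of_indicator_levels_class` (cluster form).
The proofs are those of `…KernelMixIETLayerCake` verbatim with the class hypotheses threaded through.
-/

namespace Summit.CriticalPhenomena.PercolationContinuityZ3.Theorems

open Finset Literature.Probability.Percolation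

namespace Coefficientwise

/-- **IET: real levels from 0/1 levels within a level class (abstract form).**  Version of `iet_of_indicator_levels` in which the a/b-levels range
over classes `Ph` (h-side) and `Pk` (k-side) of functions `Set V → ℝ` CLOSED UNDER THRESHOLDING (`f ↦ 1[r ≤ f]`), e.g. functions supported on a
fixed vertex set: if the form is nonnegative for all admissible 0/1 level systems with `hᵃ, hᵇ ∈ Ph`, `kᵃ, kᵇ ∈ Pk`, then for all admissible real ones with
`hᵃ, hᵇ ∈ Ph`, `kᵃ, kᵇ ∈ Pk` (same layer cake; the thresholds of a class member are class members).  (Setting as in `iet_of_indicator_levels`:) let `E` be a finite index set, `X, Y : Finset ι → Set V` arbitrary maps and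
`RD, DD` arbitrary ('supply' / 'demand') predicates.  If
  `0 ≤ Σ_{ω ⊆ E, RD ω} h(Xω)k(Xω) + Σ_{ω ⊆ E, DD ω} (hᵃ(Xω) − hᵇ(Yω))(kᵃ(Xω) − kᵇ(Yω))`
holds for all MONOTONE level systems with VALUES IN `{0,1}` and `hᵃ, hᵇ ≤ h`, `kᵃ, kᵇ ≤ k`, then it holds for all monotone real level
systems with `0 ≤ hᵃ, hᵇ ≤ h`, `0 ≤ kᵃ, kᵇ ≤ k`.  Proof: discrete layer cake (`layerCake_finset`) for each side on the finite set of values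
taken on the arguments `X ω, Y ω`, with common thresholds for `h, hᵃ, hᵇ` (resp. `k, kᵃ, kᵇ`), and bilinearity of the form. [folklore] -/
theorem iet_of_indicator_levels_class {ι V : Type*} [DecidableEq ι] (E : Finset ι) (RD DD : Finset ι → Prop) [DecidablePred RD] [DecidablePred DD]
    (X Y : Finset ι → Set V) (Ph Pk : (Set V → ℝ) → Prop)
    (hPh : ∀ (f : Set V → ℝ) (r : ℝ), Ph f → Ph (fun S => if r ≤ f S then 1 else 0))
    (hPk : ∀ (f : Set V → ℝ) (r : ℝ), Pk f → Pk (fun S => if r ≤ f S then 1 else 0))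
    (H01 : ∀ (h k ha hb ka kb : Set V → ℝ), Monotone h → Monotone k → Monotone ha → Monotone hb → Monotone ka → Monotone kb →
      (∀ S, h S = 0 ∨ h S = 1) → (∀ S, k S = 0 ∨ k S = 1) → (∀ S, ha S = 0 ∨ ha S = 1) → (∀ S, hb S = 0 ∨ hb S = 1) →
      (∀ S, ka S = 0 ∨ ka S = 1) → (∀ S, kb S = 0 ∨ kb S = 1) →
      (∀ S, ha S ≤ h S) → (∀ S, hb S ≤ h S) → (∀ S, ka S ≤ k S) → (∀ S, kb S ≤ k S) → Ph ha → Ph hb → Pk ka → Pk kb →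
      0 ≤ (∑ ω ∈ E.powerset, if RD ω then h (X ω) * k (X ω) else 0)
          + ∑ ω ∈ E.powerset, if DD ω then (ha (X ω) - hb (Y ω)) * (ka (X ω) - kb (Y ω)) else 0)
    (h k ha hb ka kb : Set V → ℝ) (mh : Monotone h) (mk : Monotone k)
    (mha : Monotone ha) (mhb : Monotone hb) (mka : Monotone ka) (mkb : Monotone kb)
    (ha0 : ∀ S, 0 ≤ ha S) (hah : ∀ S, ha S ≤ h S) (hb0 : ∀ S, 0 ≤ hb S) (hbh : ∀ S, hb S ≤ h S)
    (ka0 : ∀ S, 0 ≤ ka S) (kak : ∀ S, ka S ≤ k S) (kb0 : ∀ S, 0 ≤ kb S) (kbk : ∀ S, kb S ≤ k S)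
    (pha : Ph ha) (phb : Ph hb) (pka : Pk ka) (pkb : Pk kb) :
    0 ≤ (∑ ω ∈ E.powerset, if RD ω then h (X ω) * k (X ω) else 0)
        + ∑ ω ∈ E.powerset, if DD ω then (ha (X ω) - hb (Y ω)) * (ka (X ω) - kb (Y ω)) else 0 := by
  classical
  -- the finite set of arguments and of values
  set A : Finset (Set V) := E.powerset.image X ∪ E.powerset.image Y with hA
  have hXA : ∀ ω ∈ E.powerset, X ω ∈ A := fun ω hω => Finset.mem_union_left _ (Finset.mem_image_of_mem X hω)
  have hYA : ∀ ω ∈ E.powerset, Y ω ∈ A := fun ω hω => Finset.mem_union_right _ (Finset.mem_image_of_mem Y hω)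
  set Th : Finset ℝ := insert 0 (A.image h ∪ A.image ha ∪ A.image hb) with hTh
  set Tk : Finset ℝ := insert 0 (A.image k ∪ A.image ka ∪ A.image kb) with hTk
  have h0 : ∀ S, 0 ≤ h S := fun S => le_trans (ha0 S) (hah S)
  have k0 : ∀ S, 0 ≤ k S := fun S => le_trans (ka0 S) (kak S)
  have hThpos : ∀ v ∈ Th, 0 ≤ v := by
    intro v hv
    rw [hTh, Finset.mem_insert, Finset.mem_union, Finset.mem_union] at hv
    rcases hv with rfl | ((hv | hv) | hv)
    · exact le_refl _
    · obtain ⟨S, _, rfl⟩ := Finset.mem_image.mp hv; exact h0 S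
    · obtain ⟨S, _, rfl⟩ := Finset.mem_image.mp hv; exact ha0 S
    · obtain ⟨S, _, rfl⟩ := Finset.mem_image.mp hv; exact hb0 S
  have hTkpos : ∀ v ∈ Tk, 0 ≤ v := by
    intro v hv
    rw [hTk, Finset.mem_insert, Finset.mem_union, Finset.mem_union] at hv
    rcases hv with rfl | ((hv | hv) | hv)
    · exact le_refl _
    · obtain ⟨S, _, rfl⟩ := Finset.mem_image.mp hv; exact k0 S
    · obtain ⟨S, _, rfl⟩ := Finset.mem_image.mp hv; exact ka0 S
    · obtain ⟨S, _, rfl⟩ := Finset.mem_image.mp hv; exact kb0 S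
  have hTh0 : (0 : ℝ) ∈ Th := by rw [hTh]; exact Finset.mem_insert_self _ _
  have hTk0 : (0 : ℝ) ∈ Tk := by rw [hTk]; exact Finset.mem_insert_self _ _
  obtain ⟨n, s, c, hc, hdec⟩ := layerCake_finset Th hTh0 hThpos
  obtain ⟨n', s', c', hc', hdec'⟩ := layerCake_finset Tk hTk0 hTkpos
  -- membership of the values
  have memh : ∀ S ∈ A, h S ∈ Th := fun S hS => by
    rw [hTh]; exact Finset.mem_insert_of_mem (Finset.mem_union_left _ (Finset.mem_union_left _ (Finset.mem_image_of_mem h hS)))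
  have memha : ∀ S ∈ A, ha S ∈ Th := fun S hS => by
    rw [hTh]; exact Finset.mem_insert_of_mem (Finset.mem_union_left _ (Finset.mem_union_right _ (Finset.mem_image_of_mem ha hS)))
  have memhb : ∀ S ∈ A, hb S ∈ Th := fun S hS => by
    rw [hTh]; exact Finset.mem_insert_of_mem (Finset.mem_union_right _ (Finset.mem_image_of_mem hb hS))
  have memk : ∀ S ∈ A, k S ∈ Tk := fun S hS => by
    rw [hTk]; exact Finset.mem_insert_of_mem (Finset.mem_union_left _ (Finset.mem_union_left _ (Finset.mem_image_of_mem k hS)))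
  have memka : ∀ S ∈ A, ka S ∈ Tk := fun S hS => by
    rw [hTk]; exact Finset.mem_insert_of_mem (Finset.mem_union_left _ (Finset.mem_union_right _ (Finset.mem_image_of_mem ka hS)))
  have memkb : ∀ S ∈ A, kb S ∈ Tk := fun S hS => by
    rw [hTk]; exact Finset.mem_insert_of_mem (Finset.mem_union_right _ (Finset.mem_image_of_mem kb hS))
  -- the 0/1 level systems
  set θ : ℕ → Set V → ℝ := fun i S => if s i ≤ h S then 1 else 0 with hθ
  set θa : ℕ → Set V → ℝ := fun i S => if s i ≤ ha S then 1 else 0 with hθa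
  set θb : ℕ → Set V → ℝ := fun i S => if s i ≤ hb S then 1 else 0 with hθb
  set φ : ℕ → Set V → ℝ := fun l S => if s' l ≤ k S then 1 else 0 with hφ
  set φa : ℕ → Set V → ℝ := fun l S => if s' l ≤ ka S then 1 else 0 with hφa
  set φb : ℕ → Set V → ℝ := fun l S => if s' l ≤ kb S then 1 else 0 with hφb
  -- generic facts about threshold indicators
  have ind_mono : ∀ (f : Set V → ℝ) (r : ℝ), Monotone f → Monotone (fun S => if r ≤ f S then (1 : ℝ) else 0) := by
    intro f r mf S S' hSS'
    simp only
    by_cases h1 : r ≤ f S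
    · rw [if_pos h1, if_pos (le_trans h1 (mf hSS'))]
    · rw [if_neg h1]; by_cases h2 : r ≤ f S'
      · rw [if_pos h2]; exact zero_le_one
      · rw [if_neg h2]
  have ind_01 : ∀ (f : Set V → ℝ) (r : ℝ) (S : Set V), (if r ≤ f S then (1 : ℝ) else 0) = 0 ∨ (if r ≤ f S then (1 : ℝ) else 0) = 1 := by
    intro f r S; by_cases h1 : r ≤ f S
    · rw [if_pos h1]; exact Or.inr rfl
    · rw [if_neg h1]; exact Or.inl rfl
  have ind_le : ∀ (f g : Set V → ℝ) (r : ℝ), (∀ S, f S ≤ g S) → ∀ S, (if r ≤ f S then (1 : ℝ) else 0) ≤ (if r ≤ g S then (1 : ℝ) else 0) := by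
    intro f g r hfg S; by_cases h1 : r ≤ f S
    · rw [if_pos h1, if_pos (le_trans h1 (hfg S))]
    · rw [if_neg h1]; by_cases h2 : r ≤ g S
      · rw [if_pos h2]; exact zero_le_one
      · rw [if_neg h2]
  -- each elementary form is nonnegative
  have elem : ∀ i l, 0 ≤ (∑ ω ∈ E.powerset, if RD ω then θ i (X ω) * φ l (X ω) else 0)
      + ∑ ω ∈ E.powerset, if DD ω then (θa i (X ω) - θb i (Y ω)) * (φa l (X ω) - φb l (Y ω)) else 0 := by
    intro i l
    exact H01 (θ i) (φ l) (θa i) (θb i) (φa l) (φb l)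
      (ind_mono h (s i) mh) (ind_mono k (s' l) mk) (ind_mono ha (s i) mha) (ind_mono hb (s i) mhb)
      (ind_mono ka (s' l) mka) (ind_mono kb (s' l) mkb)
      (fun S => ind_01 h (s i) S) (fun S => ind_01 k (s' l) S) (fun S => ind_01 ha (s i) S) (fun S => ind_01 hb (s i) S)
      (fun S => ind_01 ka (s' l) S) (fun S => ind_01 kb (s' l) S)
      (ind_le ha h (s i) hah) (ind_le hb h (s i) hbh) (ind_le ka k (s' l) kak) (ind_le kb k (s' l) kbk)
      (hPh ha (s i) pha) (hPh hb (s i) phb) (hPk ka (s' l) pka) (hPk kb (s' l) pkb)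
  -- decompositions at the arguments that occur
  have dh : ∀ ω ∈ E.powerset, h (X ω) = ∑ i ∈ Finset.range n, c i * θ i (X ω) := fun ω hω => hdec _ (memh _ (hXA ω hω))
  have dha : ∀ ω ∈ E.powerset, ha (X ω) = ∑ i ∈ Finset.range n, c i * θa i (X ω) := fun ω hω => hdec _ (memha _ (hXA ω hω))
  have dhb : ∀ ω ∈ E.powerset, hb (Y ω) = ∑ i ∈ Finset.range n, c i * θb i (Y ω) := fun ω hω => hdec _ (memhb _ (hYA ω hω))
  have dk : ∀ ω ∈ E.powerset, k (X ω) = ∑ l ∈ Finset.range n', c' l * φ l (X ω) := fun ω hω => hdec' _ (memk _ (hXA ω hω))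
  have dka : ∀ ω ∈ E.powerset, ka (X ω) = ∑ l ∈ Finset.range n', c' l * φa l (X ω) := fun ω hω => hdec' _ (memka _ (hXA ω hω))
  have dkb : ∀ ω ∈ E.powerset, kb (Y ω) = ∑ l ∈ Finset.range n', c' l * φb l (Y ω) := fun ω hω => hdec' _ (memkb _ (hYA ω hω))
  -- expand the supply summands
  have keyR : ∀ ω ∈ E.powerset, (if RD ω then h (X ω) * k (X ω) else 0)
      = ∑ i ∈ Finset.range n, ∑ l ∈ Finset.range n', c i * c' l * (if RD ω then θ i (X ω) * φ l (X ω) else 0) := by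
    intro ω hω
    by_cases hR : RD ω
    · simp only [if_pos hR]
      rw [dh ω hω, dk ω hω, Finset.sum_mul_sum]
      apply Finset.sum_congr rfl; intro i _; apply Finset.sum_congr rfl; intro l _; ring
    · simp only [if_neg hR, mul_zero, Finset.sum_const_zero]
  -- expand the demand summands
  have keyD : ∀ ω ∈ E.powerset, (if DD ω then (ha (X ω) - hb (Y ω)) * (ka (X ω) - kb (Y ω)) else 0)
      = ∑ i ∈ Finset.range n, ∑ l ∈ Finset.range n', c i * c' l *
          (if DD ω then (θa i (X ω) - θb i (Y ω)) * (φa l (X ω) - φb l (Y ω)) else 0) := by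
    intro ω hω
    by_cases hD : DD ω
    · simp only [if_pos hD]
      have e1 : ha (X ω) - hb (Y ω) = ∑ i ∈ Finset.range n, c i * (θa i (X ω) - θb i (Y ω)) := by
        rw [dha ω hω, dhb ω hω, ← Finset.sum_sub_distrib]
        apply Finset.sum_congr rfl; intro i _; ring
      have e2 : ka (X ω) - kb (Y ω) = ∑ l ∈ Finset.range n', c' l * (φa l (X ω) - φb l (Y ω)) := by
        rw [dka ω hω, dkb ω hω, ← Finset.sum_sub_distrib]
        apply Finset.sum_congr rfl; intro l _; ring
      rw [e1, e2, Finset.sum_mul_sum]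
      apply Finset.sum_congr rfl; intro i _; apply Finset.sum_congr rfl; intro l _; ring
    · simp only [if_neg hD, mul_zero, Finset.sum_const_zero]
  rw [Finset.sum_congr rfl keyR, Finset.sum_congr rfl keyD]
  have eR : (∑ ω ∈ E.powerset, ∑ i ∈ Finset.range n, ∑ l ∈ Finset.range n', c i * c' l * (if RD ω then θ i (X ω) * φ l (X ω) else 0))
      = ∑ i ∈ Finset.range n, ∑ l ∈ Finset.range n', ∑ ω ∈ E.powerset, c i * c' l * (if RD ω then θ i (X ω) * φ l (X ω) else 0) := by
    rw [Finset.sum_comm]; apply Finset.sum_congr rfl; intro i _; rw [Finset.sum_comm]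
  have eD : (∑ ω ∈ E.powerset, ∑ i ∈ Finset.range n, ∑ l ∈ Finset.range n', c i * c' l *
          (if DD ω then (θa i (X ω) - θb i (Y ω)) * (φa l (X ω) - φb l (Y ω)) else 0))
      = ∑ i ∈ Finset.range n, ∑ l ∈ Finset.range n', ∑ ω ∈ E.powerset, c i * c' l *
          (if DD ω then (θa i (X ω) - θb i (Y ω)) * (φa l (X ω) - φb l (Y ω)) else 0) := by
    rw [Finset.sum_comm]; apply Finset.sum_congr rfl; intro i _; rw [Finset.sum_comm]
  rw [eR, eD, ← Finset.sum_add_distrib]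
  apply Finset.sum_nonneg
  intro i hi
  rw [← Finset.sum_add_distrib]
  apply Finset.sum_nonneg
  intro l hl
  rw [← Finset.mul_sum, ← Finset.mul_sum, ← mul_add]
  exact mul_nonneg (mul_nonneg (hc i (Finset.mem_range.mp hi)) (hc' l (Finset.mem_range.mp hl))) (elem i l)

open Classical in
/-- **IET: real levels from 0/1 levels within a level class (cluster form).**  Class version of `iet_graph_of_indicator_levels` (see
`iet_of_indicator_levels_class`): for a finite multigraph (`ends`, `E`), root `u`, observer `b`, an event `𝒱`
(no closure hypothesis is needed for this reduction) and cluster notation `X = C_u ω`, `Y = C_u(E∖ω)`: if the IET sum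
`Σ_{𝒱, b∈X∖Y} h(X)k(X) + Σ_{𝒱, b∈Y∖X} (hᵃX − hᵇY)(kᵃX − kᵇY)` is nonnegative for all monotone `{0,1}`-valued level systems with
`hᵃ, hᵇ ≤ h`, `kᵃ, kᵇ ≤ k`, then it is nonnegative for all monotone real level systems with `0 ≤ hᵃ, hᵇ ≤ h`, `0 ≤ kᵃ, kᵇ ≤ k`
(the syntactic form of `iet_cycle` / `iet_deficit_bound`).  [folklore; context: KozmaNitzan2024, Questions 8–9 (§5.5 p. 36)] -/
theorem iet_graph_of_indicator_levels_class {ι V : Type*} (ends : ι → Sym2 V) (E : Finset ι) (u b : V) (𝒱 : Finset ι → Prop)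
    (Ph Pk : (Set V → ℝ) → Prop)
    (hPh : ∀ (f : Set V → ℝ) (r : ℝ), Ph f → Ph (fun S => if r ≤ f S then 1 else 0))
    (hPk : ∀ (f : Set V → ℝ) (r : ℝ), Pk f → Pk (fun S => if r ≤ f S then 1 else 0))
    (H01 : ∀ (h k ha hb ka kb : Set V → ℝ), Monotone h → Monotone k → Monotone ha → Monotone hb → Monotone ka → Monotone kb →
      (∀ S, h S = 0 ∨ h S = 1) → (∀ S, k S = 0 ∨ k S = 1) → (∀ S, ha S = 0 ∨ ha S = 1) → (∀ S, hb S = 0 ∨ hb S = 1) →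
      (∀ S, ka S = 0 ∨ ka S = 1) → (∀ S, kb S = 0 ∨ kb S = 1) →
      (∀ S, ha S ≤ h S) → (∀ S, hb S ≤ h S) → (∀ S, ka S ≤ k S) → (∀ S, kb S ≤ k S) → Ph ha → Ph hb → Pk ka → Pk kb →
      0 ≤ (∑ ω ∈ E.powerset, if 𝒱 ω ∧ b ∈ openCluster (ends '' (↑ω : Set ι)) u ∧
              b ∉ openCluster (ends '' (↑(E \ ω) : Set ι)) u then
            h (openCluster (ends '' (↑ω : Set ι)) u) *
              k (openCluster (ends '' (↑ω : Set ι)) u) else 0)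
        + ∑ ω ∈ E.powerset, if 𝒱 ω ∧ b ∈ openCluster (ends '' (↑(E \ ω) : Set ι)) u ∧
              b ∉ openCluster (ends '' (↑ω : Set ι)) u then
            (ha (openCluster (ends '' (↑ω : Set ι)) u) -
                hb (openCluster (ends '' (↑(E \ ω) : Set ι)) u)) *
              (ka (openCluster (ends '' (↑ω : Set ι)) u) -
                kb (openCluster (ends '' (↑(E \ ω) : Set ι)) u)) else 0)
    (h k ha hb ka kb : Set V → ℝ) (mh : Monotone h) (mk : Monotone k)
    (mha : Monotone ha) (mhb : Monotone hb) (mka : Monotone ka) (mkb : Monotone kb)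
    (ha0 : ∀ S, 0 ≤ ha S) (hah : ∀ S, ha S ≤ h S) (hb0 : ∀ S, 0 ≤ hb S) (hbh : ∀ S, hb S ≤ h S)
    (ka0 : ∀ S, 0 ≤ ka S) (kak : ∀ S, ka S ≤ k S) (kb0 : ∀ S, 0 ≤ kb S) (kbk : ∀ S, kb S ≤ k S)
    (pha : Ph ha) (phb : Ph hb) (pka : Pk ka) (pkb : Pk kb) :
    0 ≤ (∑ ω ∈ E.powerset, if 𝒱 ω ∧ b ∈ openCluster (ends '' (↑ω : Set ι)) u ∧
            b ∉ openCluster (ends '' (↑(E \ ω) : Set ι)) u then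
          h (openCluster (ends '' (↑ω : Set ι)) u) *
            k (openCluster (ends '' (↑ω : Set ι)) u) else 0)
      + ∑ ω ∈ E.powerset, if 𝒱 ω ∧ b ∈ openCluster (ends '' (↑(E \ ω) : Set ι)) u ∧
            b ∉ openCluster (ends '' (↑ω : Set ι)) u then
          (ha (openCluster (ends '' (↑ω : Set ι)) u) -
              hb (openCluster (ends '' (↑(E \ ω) : Set ι)) u)) *
            (ka (openCluster (ends '' (↑ω : Set ι)) u) -
              kb (openCluster (ends '' (↑(E \ ω) : Set ι)) u)) else 0 := by
  classical
  exact iet_of_indicator_levels_class E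
    (fun ω => 𝒱 ω ∧ b ∈ openCluster (ends '' (↑ω : Set ι)) u ∧
      b ∉ openCluster (ends '' (↑(E \ ω) : Set ι)) u)
    (fun ω => 𝒱 ω ∧ b ∈ openCluster (ends '' (↑(E \ ω) : Set ι)) u ∧
      b ∉ openCluster (ends '' (↑ω : Set ι)) u)
    (fun ω => openCluster (ends '' (↑ω : Set ι)) u)
    (fun ω => openCluster (ends '' (↑(E \ ω) : Set ι)) u)
    Ph Pk hPh hPk H01 h k ha hb ka kb mh mk mha mhb mka mkb ha0 hah hb0 hbh ka0 kak kb0 kbk pha phb pka pkb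


end Coefficientwise

end Summit.CriticalPhenomena.PercolationContinuityZ3.Theorems
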